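import Summits.BirchSwinnertonDyer.Rank1Residual.X12.CMRamifiedRecordSchemaG
import HarnessLib

/-!
# Leaf `CornerF ∧ p ramified in K` (K12r): certificate-record schema, PART H — the T-PACKAGE DEFECT
# record of a regime-T class (planner PLAN v5 / INBOX 18:30:52Z «PART H = the T-package defect table … fields
# d0, d0′, dP, dP′, m, ntilde, ntilde′»; cell `bsd-print-cfram`, typer seat `ty3`)

HONEST FRAMING (cell `bsd-print-cfram`, run/shared/lean/pub/bsd-print-cfram/, verbatim in every file
of the cell): PARTITION currency only — the leaf counts when its class theorem is in the kernel BY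
NAME, flag-free; Literature named facts are statement-only with cite tags, never sorried theorems;
every imported theorem carries its printed hypotheses verbatim; numbers, not adjectives. THIS FILE IS
DATA INFRASTRUCTURE (a computable record, a decidable recheck, unpacking lemmas); nothing about any
elliptic curve is asserted, no named fact is introduced, nothing is booked, no mark moves (the leaf
K12r, its `p = 3` slice and the regime child T `LocalThreeTorsionBSDThree` = stmt-BirchSwinnertonDyer-20699
of route `PrintCFram` stay OPEN).

## What a `TRow` records (one regime-T class `W = E_k — W' = E_{k'} ≅ W^{(−3)}`, `K = ℚ(√−3)`, `𝔭 = (√−3)`)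

ty2's T package (ASK (δ), `X12/O11/RamifiedStrictDescentAtThreeRegimeT.lean`) displays two defects of a
T frame: the GLOBAL one `d₀ = #E(K)[3^∞]` and the `𝔭`-part of the local one, bounded by `#E(K_𝔭)[3^∞]`,
`K_𝔭 = ℚ₃(√−3)`; and it replaces the levels `n, n'` by the levels `ñ, ñ'` of the generators in `W(ℚ₃)`,
`W'(ℚ₃)` MODULO TORSION. For the quadratic extensions `K/ℚ` and `K_𝔭/ℚ₃` and ODD-order torsion the
`±`-eigenspaces of the non-trivial automorphism split (2 is invertible): `E(K)[3^∞] = E(ℚ)[3^∞] ⊕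
E^{(−3)}(ℚ)[3^∞]` and `E(K_𝔭)[3^∞] = E(ℚ₃)[3^∞] ⊕ E^{(−3)}(ℚ₃)[3^∞]`, with `W^{(−3)} ≅ W'`; so
**`d0 = #W(ℚ)[3^∞]·#W'(ℚ)[3^∞] = d0'`** and **`dP = #W(ℚ₃)[3^∞]·#W'(ℚ₃)[3^∞] = dP'`**. A `TRow`
carries, per member: `c₃`, `#E(ℚ)_tors` and its `3`-part `t3Q`, `t3loc = #E(ℚ₃)[3] ∈ {1,3}` (= PART C's
closed form `local3TorsCount + 1`), `t3inf = #E(ℚ₃)[3^∞] ∈ {1,3,9}` (the ORDER-9 test over `ℚ₃`; `≤ 9`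
because `E₁(ℚ₃)` is torsion-free and `#E(ℚ₃)/E₁(ℚ₃) = 3c₃ ≤ 12`, so `t3inf ∣ 3c₃`), `torsK = #E(K)_tors`
(engines, directly over the number field `K`), `torsK1 = #E(K₁)_tors` over the first anticyclotomic layer
`K₁ = K(∛3)` and `m` with `3^m = torsK1^{(3)}` (`W(K₁)[3^∞] = W[𝔭^m]`: the finite `𝒪_K`-submodules of
`W[3^∞] ≅ K_𝔭/𝒪_𝔭` are the `W[𝔭^j]`), the generator's `vlog = v₃(log_ω G)` (two engines) and
**`ntilde = vlog + v₃(c₃) − v₃(t3inf)`** (`log_ω(E(ℚ₃)) = 3^{1−e}ℤ₃` with `3^e = 3c₃^{(3)}/t3inf`, so this IS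
the level of `G` in `E(ℚ₃)/torsion ≅ ℤ₃`; `= n` of PART C when `t3inf = 1`) with engine B's DIRECT level
`nDiv` (iterated `3`-division in `E(ℚ₃)` up to torsion translates); and per class `d0`, `dP`, `tSub` (PART F).
`TRow.consistent` RECHECKS: the twist identity `k'·w₁⁶ = −27·k·w₂⁶`; regime T by the closed form
(`hasLocal3Tors k ∨ hasLocal3Tors (−27k)`); `t3loc = local3TorsCount k + 1` (and primed, via `k'`);
`t3Q = 3^{v₃(torsQ)}`; `t3loc ∣ t3inf ∣ 9`, `t3inf ∣ 3c₃`; **`d0 = 3^{v₃(torsK)} = t3Q·t3Q' = 3^{v₃(torsK')}`**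
(the engines' number-field torsion against the decomposition); `dP = t3inf·t3inf'`; `3^m = 3^{v₃(torsK1)}`,
`d0 ∣ 3^m`, the same primed; the STRUCTURAL PREDICTIONS `tSub = 1 ⟺ 3 ≤ d0 ⟺ 1 ≤ m ⟺ 1 ≤ m'` (`√k ∈ K₁ ⟺
k ∈ ℚ² ∪ −3ℚ²`: `K₁ = ℚ(ζ₃, ∛3)` has the single quadratic subfield `K`); the level identity
`ntilde + v₃(t3inf) = vlog + v₃(c₃)` and `ntilde = nDiv`, two level engines. NOT rechecked (engines, two
code bases agreeing): the torsion ORDERS over `ℚ`, `K`, `K₁`, the order-9 test, `vlog`, `c₃`.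

References: PLAN.md v5; INBOX 18:30:52Z (plan g5 → ty3 / → ty2 (δ)); `X12/CMRamifiedRecordSchema{C,F,G}.lean`;
`X12/O11/RamifiedStrictDescentAtThreeRegimeV.lean` (ty2's displayed defects); [cite: SilvermanAEC2009, IV.3.2 (b)]
(no torsion in `Ê(pℤ_p)` for `v(p) < p − 1`), [cite: SilvermanAEC2009, VII.2.1–2.2] (`E₀/E₁ ≅ Ẽ_ns`),
[cite: SilvermanAEC2009, X.5 Cor. 5.4] (twists); [Cremona1997] `ecdata allgens/allbsd`.
-/

set_option autoImplicit false

namespace Summit.BirchSwinnertonDyer.Rank1Residual.X12.CMRamifiedRecords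

open Summit.BirchSwinnertonDyer.BirchSwinnertonDyer.Rank1Residual.HeegnerIndexRecords

/-- The `3`-part `3^{v₃(n)}` of a positive integer. [folklore] -/
def part3 (n : ℕ) : ℕ := 3 ^ vp 3 (n : ℤ)

/-- **T-package defect record of a regime-T K12r@3 class** (module docstring). Unprimed fields are
`W`'s (Cremona member with the smaller number, `= E_k`), primed ones `W'`'s (`= E_{k'}`). [folklore] -/
structure TRow where
  label : String
  label' : String
  cls : String
  cond : ℕ
  k : ℤ
  k' : ℤ
  w1 : ℕ
  w2 : ℕ
  tSub : ℕ
  -- W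
  c3 : ℕ
  torsQ : ℕ
  t3Q : ℕ
  t3loc : ℕ
  t3inf : ℕ
  torsK : ℕ
  torsK1 : ℕ
  m : ℕ
  vlog : ℤ
  ntilde : ℕ
  nDiv : ℕ
  -- W'
  c3' : ℕ
  torsQ' : ℕ
  t3Q' : ℕ
  t3loc' : ℕ
  t3inf' : ℕ
  torsK' : ℕ
  torsK1' : ℕ
  m' : ℕ
  vlog' : ℤ
  ntilde' : ℕ
  nDiv' : ℕ
  -- class
  d0 : ℕ
  dP : ℕ
  levelEngines : ℕ

namespace TRow

/-- Block 1 (shape): `k ≠ 0`, twist identity, `tSub ∈ {1,2}`, `1 ≤ c₃, c₃' ≤ 4`, torsion orders `≥ 1`,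
regime T by the closed form. [folklore] -/
def shapeOK (r : TRow) : Bool :=
  (r.k != 0) && decide (1 ≤ r.w1) && decide (1 ≤ r.w2) &&
  (r.k' * (r.w1 : ℤ) ^ 6 == -27 * r.k * (r.w2 : ℤ) ^ 6) && (r.tSub == 1 || r.tSub == 2) &&
  decide (1 ≤ r.c3) && decide (r.c3 ≤ 4) && decide (1 ≤ r.c3') && decide (r.c3' ≤ 4) &&
  decide (1 ≤ r.torsQ) && decide (1 ≤ r.torsQ') && decide (1 ≤ r.torsK) && decide (1 ≤ r.torsK') &&
  decide (1 ≤ r.torsK1) && decide (1 ≤ r.torsK1') &&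
  (hasLocal3Tors r.k || hasLocal3Tors (-27 * r.k))

/-- The local torsion checks of ONE member: `t3loc = local3TorsCount k + 1` (closed form), `t3Q = torsQ^{(3)}`,
`t3loc ∣ t3inf`, `t3inf ∣ 9`, `t3inf ∣ 3c₃`. [folklore] -/
def locTorsOK (k : ℤ) (c3 torsQ t3Q t3loc t3inf : ℕ) : Bool :=
  (t3loc == local3TorsCount k + 1) && (t3Q == part3 torsQ) &&
  (t3inf % t3loc == 0) && ((9 : ℕ) % t3inf == 0) && ((3 * c3) % t3inf == 0)

/-- Block 2 (torsion over `ℚ`, `ℚ₃` for both members). [folklore] -/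
def torsOK (r : TRow) : Bool :=
  locTorsOK r.k r.c3 r.torsQ r.t3Q r.t3loc r.t3inf && locTorsOK r.k' r.c3' r.torsQ' r.t3Q' r.t3loc' r.t3inf'

/-- Block 3 (the defects): `d0 = torsK^{(3)} = t3Q·t3Q' = torsK'^{(3)}` (decomposition), `dP = t3inf·t3inf'`,
`3^m = torsK1^{(3)}`, `3^{m'} = torsK1'^{(3)}`, `d0 ∣ 3^m`, `d0 ∣ 3^{m'}`, and the structural predictions
`tSub = 1 ⟺ 3 ≤ d0 ⟺ 1 ≤ m ⟺ 1 ≤ m'`. [folklore] -/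
def defectOK (r : TRow) : Bool :=
  (r.d0 == part3 r.torsK) && (r.d0 == r.t3Q * r.t3Q') && (part3 r.torsK' == r.d0) &&
  (r.dP == r.t3inf * r.t3inf') &&
  (3 ^ r.m == part3 r.torsK1) && (3 ^ r.m' == part3 r.torsK1') &&
  (3 ^ r.m % r.d0 == 0) && (3 ^ r.m' % r.d0 == 0) &&
  ((r.tSub == 1) == decide (3 ≤ r.d0)) && ((r.tSub == 1) == decide (1 ≤ r.m)) &&
  ((r.tSub == 1) == decide (1 ≤ r.m'))

/-- The level identity of ONE member: `ntilde + v₃(t3inf) = vlog + v₃(c₃)` and `ntilde = nDiv`. [folklore] -/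
def levelOK₁ (c3 t3inf : ℕ) (vlog : ℤ) (ntilde nDiv : ℕ) : Bool :=
  ((ntilde : ℤ) + (vp 3 (t3inf : ℤ) : ℤ) == vlog + (vp 3 (c3 : ℤ) : ℤ)) && (ntilde == nDiv)

/-- Block 4 (levels mod torsion, both members, two engines). [folklore] -/
def levelOK (r : TRow) : Bool :=
  levelOK₁ r.c3 r.t3inf r.vlog r.ntilde r.nDiv && levelOK₁ r.c3' r.t3inf' r.vlog' r.ntilde' r.nDiv' &&
  decide (2 ≤ r.levelEngines)

/-- **The in-kernel recheck of a `TRow`**: the four blocks. [folklore] -/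
def consistent (r : TRow) : Bool :=
  r.shapeOK && r.torsOK && r.defectOK && r.levelOK

/-- `consistent` unpacked into its four blocks. [folklore] -/
theorem consistent_iff (r : TRow) :
    r.consistent = true ↔ r.shapeOK = true ∧ r.torsOK = true ∧ r.defectOK = true ∧ r.levelOK = true := by
  simp only [consistent, Bool.and_eq_true]
  tauto

/-! ### Unpacking a consistent record -/

/-- **The defects of a consistent T record**: `d0 = #W(ℚ)[3^∞]^{}·#W'(ℚ)[3^∞]^{}` (recorded `3`-parts)
`= torsK^{(3)} = torsK'^{(3)}`, `dP = t3inf·t3inf'`, `3^m = torsK1^{(3)}`, `3^{m'} = torsK1'^{(3)}`. [folklore] -/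
theorem defects_of_consistent {r : TRow} (h : r.consistent = true) :
    r.d0 = part3 r.torsK ∧ r.d0 = r.t3Q * r.t3Q' ∧ part3 r.torsK' = r.d0 ∧ r.dP = r.t3inf * r.t3inf' ∧
      3 ^ r.m = part3 r.torsK1 ∧ 3 ^ r.m' = part3 r.torsK1' := by
  obtain ⟨-, -, hd, -⟩ := (consistent_iff r).1 h
  simp only [defectOK, Bool.and_eq_true, beq_iff_eq] at hd
  obtain ⟨⟨⟨⟨⟨⟨⟨⟨⟨⟨h1, h2⟩, h3⟩, h4⟩, h5⟩, h6⟩, -⟩, -⟩, -⟩, -⟩, -⟩ := hd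
  exact ⟨h1, h2, h3, h4, h5, h6⟩

/-- **The structural predictions hold on a consistent record**: cube type iff `3 ≤ d0` iff `1 ≤ m`
iff `1 ≤ m'`. [folklore] -/
theorem tSub_eq_one_iff_of_consistent {r : TRow} (h : r.consistent = true) :
    (r.tSub = 1 ↔ 3 ≤ r.d0) ∧ (r.tSub = 1 ↔ 1 ≤ r.m) ∧ (r.tSub = 1 ↔ 1 ≤ r.m') := by
  obtain ⟨-, -, hd, -⟩ := (consistent_iff r).1 h
  simp only [defectOK, Bool.and_eq_true] at hd
  obtain ⟨⟨⟨-, h1⟩, h2⟩, h3⟩ := hd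
  have key : ∀ (b : Bool) (P : Prop) [Decidable P], (b == decide P) = true → ((b = true) ↔ P) := by
    intro b P _ hb
    rw [beq_iff_eq] at hb
    rw [hb, decide_eq_true_iff]
  have e1 := key _ _ h1
  have e2 := key _ _ h2
  have e3 := key _ _ h3
  rw [beq_iff_eq] at e1 e2 e3
  exact ⟨e1, e2, e3⟩

/-- **The levels mod torsion of a consistent record**: `ntilde + v₃(t3inf) = vlog + v₃(c₃)`, `ntilde = nDiv`,
and the same primed. [folklore] -/
theorem levels_of_consistent {r : TRow} (h : r.consistent = true) :
    ((r.ntilde : ℤ) + vp 3 (r.t3inf : ℤ) = r.vlog + vp 3 (r.c3 : ℤ) ∧ r.ntilde = r.nDiv) ∧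
      ((r.ntilde' : ℤ) + vp 3 (r.t3inf' : ℤ) = r.vlog' + vp 3 (r.c3' : ℤ) ∧ r.ntilde' = r.nDiv') := by
  obtain ⟨-, -, -, hl⟩ := (consistent_iff r).1 h
  simp only [levelOK, levelOK₁, Bool.and_eq_true, beq_iff_eq] at hl
  obtain ⟨⟨⟨h1, h2⟩, ⟨h3, h4⟩⟩, -⟩ := hl
  exact ⟨⟨h1, h2⟩, ⟨h3, h4⟩⟩

/-- The local torsion bounds of a consistent record: `t3loc ∣ t3inf`, `t3inf ∣ 9`, `t3inf ∣ 3c₃` (both members),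
and `t3loc = local3TorsCount k + 1`. [folklore] -/
theorem locTors_of_consistent {r : TRow} (h : r.consistent = true) :
    (r.t3loc = local3TorsCount r.k + 1 ∧ r.t3loc ∣ r.t3inf ∧ r.t3inf ∣ 9 ∧ r.t3inf ∣ 3 * r.c3) ∧
      (r.t3loc' = local3TorsCount r.k' + 1 ∧ r.t3loc' ∣ r.t3inf' ∧ r.t3inf' ∣ 9 ∧ r.t3inf' ∣ 3 * r.c3') := by
  obtain ⟨-, ht, -, -⟩ := (consistent_iff r).1 h
  simp only [torsOK, locTorsOK, Bool.and_eq_true, beq_iff_eq] at ht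
  obtain ⟨⟨⟨⟨⟨h1, -⟩, h2⟩, h3⟩, h4⟩, ⟨⟨⟨⟨h5, -⟩, h6⟩, h7⟩, h8⟩⟩ := ht
  exact ⟨⟨h1, Nat.dvd_of_mod_eq_zero h2, Nat.dvd_of_mod_eq_zero h3, Nat.dvd_of_mod_eq_zero h4⟩,
    ⟨h5, Nat.dvd_of_mod_eq_zero h6, Nat.dvd_of_mod_eq_zero h7, Nat.dvd_of_mod_eq_zero h8⟩⟩

end TRow

/-- The tally of a list of T records: `(#rows, #{d0 = 3}, #{t3inf = 9 ∨ t3inf' = 9}, #{2 ≤ m ∨ 2 ≤ m'})`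
(cube-type count, classes with a `ℚ₃`-point of order `9` on a member, classes whose `K₁`-torsion reaches `W[𝔭²]`).
[folklore] -/
def tTally (rs : List TRow) : ℕ × ℕ × ℕ × ℕ :=
  (rs.length, (rs.filter fun r => r.d0 == 3).length,
    (rs.filter fun r => r.t3inf == 9 || r.t3inf' == 9).length,
    (rs.filter fun r => decide (2 ≤ r.m) || decide (2 ≤ r.m')).length)

/-- Display check: all records consistent and the tally as stated. [folklore] -/
def tCheck (rs : List TRow) (t : ℕ × ℕ × ℕ × ℕ) : Bool :=
  rs.all TRow.consistent && (tTally rs == t)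

/-- Unpacking `tCheck`. [folklore] -/
theorem tCheck_iff (rs : List TRow) (t : ℕ × ℕ × ℕ × ℕ) :
    tCheck rs t = true ↔ rs.all TRow.consistent = true ∧ tTally rs = t := by
  simp only [tCheck, Bool.and_eq_true, beq_iff_eq]

/-- Unpacking a display theorem per member. [folklore] -/
theorem TRow.consistent_of_tCheck {rs : List TRow} {t : ℕ × ℕ × ℕ × ℕ} (h : tCheck rs t = true)
    {r : TRow} (hr : r ∈ rs) : r.consistent = true :=
  List.all_eq_true.1 ((tCheck_iff rs t).1 h).1 r hr

end Summit.BirchSwinnertonDyer.Rank1Residual.X12.CMRamifiedRecords
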